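import Summits.HubbardSuperconductivity.HubbardSuperconductivity.Theorems.AnisotropyChordDressHalfFilledSecondOrderUpper
import HarnessLib

/-!
# Crux `DressHalfFilled` (stmt-HubbardSuperconductivity-8148, routes `AnisotropyChord` / `LevyLogBootstrap`), stub 3
# `stub_dressHalfFilled`: KATO'S SECOND-ORDER LOWER BOUND (abstract, gapped unperturbed sector)

Helper file (`--supports stmt-HubbardSuperconductivity-8148`), the counterpart of `…SecondOrderUpper`. Notation: `H₀, T`
Hermitian matrices, `E₀ : ℝ`, `P = eigenProj H₀ E₀`, `S = reducedResolvent H₀ E₀` (Kato), `K` a subspace (a symmetry sector)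
stable under `T`, `S`, `P`, on which `H₀ ≥ E₀`; `𝒜(v) = Re⟨v, H₀ v⟩ − E₀‖v‖²`.

* `sub_smul_mulVec_eigenProj` — `H₀ (P v) = E₀ • P v` (the eigenprojection lands in the eigenspace; functional calculus);
* `le_minEnergyOn_of_forall'` — a lower bound valid on every unit vector of a sector bounds the sector energy from below;
* `kato_completing_square` — for `q ∈ K` with `P q = 0` and `b ∈ K`: `𝒜(q) + 2Re⟨q, b⟩ + Re⟨b, S b⟩ ≥ 0`
  (`0 ≤ 𝒜(q + S b)`, `(H₀ − E₀) S = 1 − P`, `P S = 0`);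
* `minEnergyOn_ge_second_order` — **the lower bound**: if moreover `H₀ − E₀ ≥ g > 0` on `K ∩ ker P` (GAP), `|Re⟨v, T v⟩| ≤ τ‖v‖²`
  on `K`, the first-order term vanishes on `P K` (`Re⟨Pv, T Pv⟩ = 0`) and the second-order form is bounded there,
  `Re⟨T Pv, S T Pv⟩ ≤ κ‖Pv‖²` with `κ ≥ 0`, then for `0 ≤ t`, `tτ < g`:
  **`E₀ − t²·κ / (1 − tτ/g) ≤ E_K(H₀ + tT)`**.
  With `…SecondOrderUpper` (`E_K ≤ E₀ − t² Re⟨Ta, S Ta⟩ + O(t³)` for every dressed ground vector `a`) this pins the sector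
  energy to second order: `E_K(H₀ + tT) = E₀ − t²·sup_{unit p ∈ PK} Re⟨Tp, S Tp⟩ + O(t³)` whenever that supremum is `≥ 0`
  — for the plaquette dictionary the supremum is `−inf spec(2J·XXZ(Δ_eff) + k)` on the boson sector (clause (d)).

HONEST LABEL: abstract finite-dimensional perturbation theory at fixed volume (the gap `g`, the bound `τ ~ ‖T‖` and hence the
admissible `t` all degrade with `L`); the plaquette-torus instance (gap of `H_in` above `E₀` inside the sector from (W3)–(W5),
`‖T‖ ≤ 8L²`, exhaustion (c)) is NOT assembled here; nothing uniform in `L`; no crux and no summit statement is proved.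
Sources: T. Kato, *Perturbation Theory for Linear Operators* (1966) II-§2.3, I-§5.3 [Kato1966]; H. Tasaki (2020) §2.1.
No definition and no named fact is introduced; sorry-free.
-/

noncomputable section

-- `dupNamespace`: the summit and the problem are both named `HubbardSuperconductivity` (layout D-0022)
set_option linter.dupNamespace false

namespace Summit.HubbardSuperconductivity.HubbardSuperconductivity.Theorems.AnisotropyChord.DressSecond

open Matrix Literature.MathematicalPhysics.QuantumLattice
open scoped ComplexOrder

variable {m : Type*} [Fintype m] [DecidableEq m]

/-- `(H₀ − E) P = 0`: the eigenprojection maps into the `E`-eigenspace (functional calculus: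
`(x − E)·𝟙_{x = E} = 0`). Kato (1966) I-§5.3 (5.26). [folklore] -/
theorem sub_mul_eigenProj {H₀ : Matrix m m ℂ} (hH : H₀.IsHermitian) (E : ℝ) :
    (H₀ - algebraMap ℝ _ E) * eigenProj H₀ E = 0 := by
  have hsa : IsSelfAdjoint H₀ := hH
  have h1 : H₀ - algebraMap ℝ _ E = cfc (fun x : ℝ => x - E) H₀ := by
    rw [cfc_sub _ _ H₀ (continuousOn_spectrum_real H₀ _) (continuousOn_spectrum_real H₀ _),
      cfc_id' ℝ H₀, cfc_const E H₀]
  rw [h1, eigenProj, ← cfc_mul _ _ H₀ (continuousOn_spectrum_real H₀ _) (continuousOn_spectrum_real H₀ _)]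
  convert cfc_zero ℝ H₀ using 2
  ext x
  by_cases hx : x = E <;> simp [hx]

/-- `H₀ (P v) = E • P v`. [folklore] -/
theorem mulVec_eigenProj_mulVec {H₀ : Matrix m m ℂ} (hH : H₀.IsHermitian) (E : ℝ) (v : m → ℂ) :
    H₀ *ᵥ (eigenProj H₀ E *ᵥ v) = (E : ℂ) • (eigenProj H₀ E *ᵥ v) := by
  have h := congrArg (fun X => X *ᵥ v) (sub_mul_eigenProj hH E)
  simp only [zero_mulVec] at h
  rw [← mulVec_mulVec, sub_mulVec, sub_eq_zero, IsScalarTower.algebraMap_apply ℝ ℂ (Matrix m m ℂ),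
    Algebra.algebraMap_eq_smul_one, smul_mulVec, one_mulVec] at h
  rw [h]
  rfl

omit [DecidableEq m] in
/-- **A uniform lower bound on the Rayleigh quotients of a sector bounds the sector energy from below** (the sector
must carry a unit vector, else `minEnergyOn` is the junk value `0`). Tasaki (2020) §2.1. [folklore] -/
theorem le_minEnergyOn_of_forall' (H : Matrix m m ℂ) (K : Submodule ℂ (m → ℂ))
    (hne : ∃ v ∈ K, star v ⬝ᵥ v = 1) {c : ℝ}
    (h : ∀ ψ ∈ K, star ψ ⬝ᵥ ψ = 1 → c ≤ (star ψ ⬝ᵥ (H *ᵥ ψ)).re) :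
    c ≤ H.minEnergyOn K := by
  obtain ⟨v, hv, hv1⟩ := hne
  refine le_csInf ⟨_, ⟨v, hv, hv1, rfl⟩⟩ ?_
  rintro E ⟨ψ, hψ, hψ1, rfl⟩
  exact h ψ hψ hψ1

/-- **Kato's completing-the-square inequality.** `H₀` Hermitian with `H₀ ≥ E₀` on `K`, `S = reducedResolvent H₀ E₀`,
`P = eigenProj H₀ E₀`; for `q ∈ K` with `P q = 0` and `b` with `S b ∈ K`:
`0 ≤ (Re⟨q, H₀ q⟩ − E₀‖q‖²) + 2Re⟨q, b⟩ + Re⟨b, S b⟩` — it is `Re⟨u, (H₀ − E₀) u⟩ ≥ 0` for `u = q + S b`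
(`(H₀ − E₀)S = 1 − P`, `P S = 0`). Kato (1966) II-§2.3. [folklore] -/
theorem kato_completing_square {H₀ : Matrix m m ℂ} (hH₀ : H₀.IsHermitian) (K : Submodule ℂ (m → ℂ)) {E₀ : ℝ}
    (hE₀ : ∀ v ∈ K, E₀ * (star v ⬝ᵥ v).re ≤ (star v ⬝ᵥ (H₀ *ᵥ v)).re)
    {q b : m → ℂ} (hq : q ∈ K) (hSb : reducedResolvent H₀ E₀ *ᵥ b ∈ K)
    (hPq : eigenProj H₀ E₀ *ᵥ q = 0) :
    0 ≤ ((star q ⬝ᵥ (H₀ *ᵥ q)).re - E₀ * (star q ⬝ᵥ q).re) + 2 * (star q ⬝ᵥ b).re +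
      (star b ⬝ᵥ (reducedResolvent H₀ E₀ *ᵥ b)).re := by
  set S := reducedResolvent H₀ E₀ with hS
  set P := eigenProj H₀ E₀ with hP
  have hSh : S.IsHermitian := reducedResolvent_isHermitian H₀ E₀
  have hPh : P.IsHermitian := eigenProj_isHermitian H₀ E₀
  -- `H₀ (S b) = E₀ S b + (b − P b)`
  have h1 : (H₀ - algebraMap ℝ (Matrix m m ℂ) E₀) *ᵥ (S *ᵥ b) = b - P *ᵥ b := by
    rw [mulVec_mulVec, sub_mul_reducedResolvent hH₀ E₀, sub_mulVec, one_mulVec]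
  have h2 : (algebraMap ℝ (Matrix m m ℂ) E₀) *ᵥ (S *ᵥ b) = (E₀ : ℂ) • (S *ᵥ b) := by
    rw [IsScalarTower.algebraMap_apply ℝ ℂ (Matrix m m ℂ), Algebra.algebraMap_eq_smul_one, smul_mulVec, one_mulVec]
    rfl
  have hHSb : H₀ *ᵥ (S *ᵥ b) = (E₀ : ℂ) • (S *ᵥ b) + (b - P *ᵥ b) := by
    rw [← h1, sub_mulVec, h2]; abel
  -- the vanishing cross terms
  have hqPb : star q ⬝ᵥ (P *ᵥ b) = 0 := by
    rw [RayleighBottom.star_dotProduct_mulVec_eq, hPh.eq, hPq, star_zero, zero_dotProduct]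
  have hSbPb : star (S *ᵥ b) ⬝ᵥ (P *ᵥ b) = 0 := by
    rw [RayleighBottom.star_dotProduct_mulVec_eq, hPh.eq, mulVec_mulVec, eigenProj_mul_reducedResolvent, zero_mulVec,
      star_zero, zero_dotProduct]
  -- `⟨S b, H₀ q⟩ = ⟨H₀ S b, q⟩`
  have hSbHq : star (S *ᵥ b) ⬝ᵥ (H₀ *ᵥ q) = star ((E₀ : ℂ) • (S *ᵥ b) + (b - P *ᵥ b)) ⬝ᵥ q := by
    rw [RayleighBottom.star_dotProduct_mulVec_eq, hH₀.eq, hHSb]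
  have hPbq : star (P *ᵥ b) ⬝ᵥ q = 0 := by
    rw [star_dotProduct, hqPb, star_zero]
  -- the vector `u = q + S b ∈ K` and `0 ≤ 𝒜(u)`
  have hu : q + S *ᵥ b ∈ K := K.add_mem hq hSb
  have h0 := hE₀ _ hu
  -- expand `⟨u, H₀ u⟩` and `⟨u, u⟩`
  have eH : star (q + S *ᵥ b) ⬝ᵥ (H₀ *ᵥ (q + S *ᵥ b)) =
      star q ⬝ᵥ (H₀ *ᵥ q) + (star q ⬝ᵥ b + (E₀ : ℂ) * (star q ⬝ᵥ (S *ᵥ b))) +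
        ((E₀ : ℂ) * (star b ⬝ᵥ (S *ᵥ q)) + star b ⬝ᵥ q) +
          ((E₀ : ℂ) * (star (S *ᵥ b) ⬝ᵥ (S *ᵥ b)) + star (S *ᵥ b) ⬝ᵥ b) := by
    rw [mulVec_add, star_add, add_dotProduct, dotProduct_add, dotProduct_add, hHSb, hSbHq]
    rw [dotProduct_add, dotProduct_smul, dotProduct_sub, hqPb, sub_zero, star_add, star_smul, add_dotProduct,
      smul_dotProduct, star_sub, sub_dotProduct, hPbq, sub_zero, dotProduct_add, dotProduct_smul, dotProduct_sub,
      hSbPb, sub_zero, Complex.star_def, Complex.conj_ofReal]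
    have e1 : star (S *ᵥ b) ⬝ᵥ q = star b ⬝ᵥ (S *ᵥ q) := by
      rw [RayleighBottom.star_dotProduct_mulVec_eq S b q, hSh.eq]
    rw [e1, smul_eq_mul, smul_eq_mul, smul_eq_mul]
    ring
  have eN : star (q + S *ᵥ b) ⬝ᵥ (q + S *ᵥ b) =
      star q ⬝ᵥ q + star q ⬝ᵥ (S *ᵥ b) + (star b ⬝ᵥ (S *ᵥ q) + star (S *ᵥ b) ⬝ᵥ (S *ᵥ b)) := by
    rw [star_add, add_dotProduct, dotProduct_add, dotProduct_add]
    have e1 : star (S *ᵥ b) ⬝ᵥ q = star b ⬝ᵥ (S *ᵥ q) := by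
      rw [RayleighBottom.star_dotProduct_mulVec_eq S b q, hSh.eq]
    rw [e1]
  rw [eH, eN] at h0
  -- real parts: `⟨b, q⟩ = conj ⟨q, b⟩`, `⟨Sb, b⟩ = conj⟨b, Sb⟩`
  have r1 : (star b ⬝ᵥ q).re = (star q ⬝ᵥ b).re := by
    rw [star_dotProduct, Complex.star_def, Complex.conj_re]
  have r2 : (star (S *ᵥ b) ⬝ᵥ b).re = (star b ⬝ᵥ (S *ᵥ b)).re := by
    rw [star_dotProduct b, Complex.star_def, Complex.conj_re]
  simp only [Complex.add_re, Complex.re_ofReal_mul] at h0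
  rw [r1, r2] at h0
  linarith

/-- **Kato's second-order lower bound for a gapped unperturbed sector.** `H₀, T` Hermitian; `P = eigenProj H₀ E₀`,
`S = reducedResolvent H₀ E₀`; `K` a subspace carrying a unit vector and stable under `T`, `S`, `P`; `H₀ ≥ E₀` on `K` and
`H₀ − E₀ ≥ g > 0` on `K ∩ ker P` (gap); `|Re⟨v, Tv⟩| ≤ τ‖v‖²` on `K`; no first-order term on `PK` (`Re⟨Pv, T Pv⟩ = 0`); the
second-order form bounded on `PK`, `Re⟨T Pv, S T Pv⟩ ≤ κ‖Pv‖²`, `κ ≥ 0`. Then for `0 ≤ t` with `tτ < g`: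
`E₀ − t²κ/(1 − tτ/g) ≤ E_K(H₀ + tT)`. Proof: for a unit `ψ ∈ K` write `ψ = p + q`, `p = Pψ`; then
`Re⟨ψ,(H₀ + tT − E₀)ψ⟩ = 𝒜(q) + 2t Re⟨q, Tp⟩ + t Re⟨q, Tq⟩ ≥ λ𝒜(q) + 2t Re⟨q, Tp⟩ ≥ −(t²/λ) Re⟨Tp, S Tp⟩`
(`λ = 1 − tτ/g`, completing the square with `b = (t/λ) Tp`). Kato (1966) II-§2.3. [folklore] -/
theorem minEnergyOn_ge_second_order {H₀ T : Matrix m m ℂ} (hH₀ : H₀.IsHermitian) (hT : T.IsHermitian)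
    (K : Submodule ℂ (m → ℂ)) {E₀ g τ κ t : ℝ}
    (hne : ∃ v ∈ K, star v ⬝ᵥ v = 1)
    (hKT : ∀ v ∈ K, T *ᵥ v ∈ K) (hKS : ∀ v ∈ K, reducedResolvent H₀ E₀ *ᵥ v ∈ K)
    (hKP : ∀ v ∈ K, eigenProj H₀ E₀ *ᵥ v ∈ K)
    (hE₀ : ∀ v ∈ K, E₀ * (star v ⬝ᵥ v).re ≤ (star v ⬝ᵥ (H₀ *ᵥ v)).re)
    (hg : 0 < g)
    (hgap : ∀ v ∈ K, eigenProj H₀ E₀ *ᵥ v = 0 →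
      g * (star v ⬝ᵥ v).re ≤ (star v ⬝ᵥ (H₀ *ᵥ v)).re - E₀ * (star v ⬝ᵥ v).re)
    (hτ : ∀ v ∈ K, |(star v ⬝ᵥ (T *ᵥ v)).re| ≤ τ * (star v ⬝ᵥ v).re)
    (hPTP : ∀ v ∈ K, (star (eigenProj H₀ E₀ *ᵥ v) ⬝ᵥ (T *ᵥ (eigenProj H₀ E₀ *ᵥ v))).re = 0)
    (hκ : 0 ≤ κ)
    (hker : ∀ v ∈ K, (star (T *ᵥ (eigenProj H₀ E₀ *ᵥ v)) ⬝ᵥ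
        (reducedResolvent H₀ E₀ *ᵥ (T *ᵥ (eigenProj H₀ E₀ *ᵥ v)))).re ≤
      κ * (star (eigenProj H₀ E₀ *ᵥ v) ⬝ᵥ (eigenProj H₀ E₀ *ᵥ v)).re)
    (ht0 : 0 ≤ t) (htg : t * τ < g) :
    E₀ - t ^ 2 * κ / (1 - t * τ / g) ≤ (H₀ + (t : ℂ) • T).minEnergyOn K := by
  set S := reducedResolvent H₀ E₀ with hS
  set P := eigenProj H₀ E₀ with hP
  have hSh : S.IsHermitian := reducedResolvent_isHermitian H₀ E₀
  have hPh : P.IsHermitian := eigenProj_isHermitian H₀ E₀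
  have hτ0 : 0 ≤ τ := by
    obtain ⟨v, hv, hv1⟩ := hne
    have h := hτ v hv
    rw [hv1, Complex.one_re, mul_one] at h
    exact (abs_nonneg _).trans h
  set lam : ℝ := 1 - t * τ / g with hlam
  have hlam0 : 0 < lam := by
    rw [hlam, sub_pos, div_lt_one hg]; exact htg
  have hlam1 : lam ≤ 1 := by
    rw [hlam, sub_le_self_iff]; positivity
  refine le_minEnergyOn_of_forall' _ K hne fun ψ hψ hψ1 => ?_
  -- decomposition `ψ = p + q`
  set p := P *ᵥ ψ with hp
  set q := ψ - p with hq
  have hpK : p ∈ K := hKP ψ hψ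
  have hqK : q ∈ K := K.sub_mem hψ hpK
  have hPq : P *ᵥ q = 0 := by
    rw [hq, mulVec_sub, hp, mulVec_mulVec, eigenProj_mul_eigenProj, sub_self]
  have hψpq : ψ = p + q := by rw [hq]; abel
  have hHp : H₀ *ᵥ p = (E₀ : ℂ) • p := mulVec_eigenProj_mulVec hH₀ E₀ ψ
  -- cross terms `⟨p, q⟩ = 0`, `⟨p, H₀ q⟩ = 0`, `⟨q, H₀ p⟩ = 0`
  have hpq : star p ⬝ᵥ q = 0 := by
    rw [hp, star_mulVec, ← dotProduct_mulVec, hPh.eq, hPq, dotProduct_zero]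
  have hqp : star q ⬝ᵥ p = 0 := by rw [star_dotProduct, hpq, star_zero]
  have hpHq : star p ⬝ᵥ (H₀ *ᵥ q) = 0 := by
    rw [RayleighBottom.star_dotProduct_mulVec_eq, hH₀.eq, hHp, star_smul, smul_dotProduct, hpq, smul_zero]
  have hqHp : star q ⬝ᵥ (H₀ *ᵥ p) = 0 := by
    rw [hHp, dotProduct_smul, hqp, smul_zero]
  have hqTp : (star q ⬝ᵥ (T *ᵥ p)).re = (star p ⬝ᵥ (T *ᵥ q)).re := by
    rw [RayleighBottom.star_dotProduct_mulVec_eq, hT.eq, star_dotProduct, Complex.star_def, Complex.conj_re]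
  -- norms: `1 = ‖p‖² + ‖q‖²`
  set np : ℝ := (star p ⬝ᵥ p).re with hnp
  set nq : ℝ := (star q ⬝ᵥ q).re with hnq
  have hnp0 : 0 ≤ np := (Complex.nonneg_iff.mp (dotProduct_star_self_nonneg p)).1
  have hnq0 : 0 ≤ nq := (Complex.nonneg_iff.mp (dotProduct_star_self_nonneg q)).1
  have hnorm : np + nq = 1 := by
    have h := congrArg Complex.re hψ1
    rw [hψpq, star_add, add_dotProduct, dotProduct_add, dotProduct_add, hpq, hqp, add_zero, zero_add,
      Complex.add_re, Complex.one_re] at h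
    rw [hnp, hnq]; exact h
  -- the Rayleigh quotient, expanded
  set A : ℝ := (star q ⬝ᵥ (H₀ *ᵥ q)).re - E₀ * nq with hA
  set η : ℝ := (star q ⬝ᵥ (T *ᵥ p)).re with hη
  set θ : ℝ := (star q ⬝ᵥ (T *ᵥ q)).re with hθ
  have hR : (star ψ ⬝ᵥ ((H₀ + (t : ℂ) • T) *ᵥ ψ)).re = E₀ + A + 2 * t * η + t * θ := by
    have e : star ψ ⬝ᵥ ((H₀ + (t : ℂ) • T) *ᵥ ψ) =
        (E₀ : ℂ) * (star p ⬝ᵥ p) + star q ⬝ᵥ (H₀ *ᵥ q) +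
          (t : ℂ) * (star p ⬝ᵥ (T *ᵥ p) + star p ⬝ᵥ (T *ᵥ q) + star q ⬝ᵥ (T *ᵥ p) + star q ⬝ᵥ (T *ᵥ q)) := by
      rw [add_mulVec, smul_mulVec, dotProduct_add, dotProduct_smul, smul_eq_mul]
      conv_lhs => rw [hψpq]
      rw [star_add, mulVec_add, mulVec_add, add_dotProduct, dotProduct_add, dotProduct_add, add_dotProduct,
        dotProduct_add, dotProduct_add, hpHq, hqHp, hHp, dotProduct_smul, smul_eq_mul]
      ring
    rw [e]
    simp only [Complex.add_re, Complex.re_ofReal_mul]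
    rw [hPTP ψ hψ, ← hqTp, ← hnp, ← hη, ← hθ, hA]
    have : np = 1 - nq := by linarith
    rw [this]; ring
  -- gap and `τ`-bound on `q`
  have hAq : g * nq ≤ A := by
    have h := hgap q hqK hPq
    rw [← hnq] at h; rw [hA]; linarith
  have hθq : -(τ * nq) ≤ θ := by
    have h := hτ q hqK
    rw [← hnq, ← hθ] at h
    exact neg_le_of_abs_le h
  have hA0 : 0 ≤ A := le_trans (mul_nonneg hg.le hnq0) hAq
  -- completing the square with `b = (t/λ) T p`
  have hbK : ((t / lam : ℝ) : ℂ) • (T *ᵥ p) ∈ K := K.smul_mem _ (hKT p hpK)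
  have hSbK : S *ᵥ (((t / lam : ℝ) : ℂ) • (T *ᵥ p)) ∈ K := hKS _ hbK
  have hsq := kato_completing_square hH₀ K hE₀ hqK hSbK hPq
  -- rewrite its three terms
  have e1 : (star q ⬝ᵥ (((t / lam : ℝ) : ℂ) • (T *ᵥ p))).re = t / lam * η := by
    rw [dotProduct_smul, smul_eq_mul, Complex.re_ofReal_mul, hη]
  have e2 : (star (((t / lam : ℝ) : ℂ) • (T *ᵥ p)) ⬝ᵥ (S *ᵥ (((t / lam : ℝ) : ℂ) • (T *ᵥ p)))).re =
      (t / lam) ^ 2 * (star (T *ᵥ p) ⬝ᵥ (S *ᵥ (T *ᵥ p))).re := by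
    rw [mulVec_smul, star_smul, smul_dotProduct, dotProduct_smul, Complex.star_def, Complex.conj_ofReal, smul_eq_mul,
      smul_eq_mul, ← mul_assoc, ← Complex.ofReal_mul, Complex.re_ofReal_mul]
    ring
  rw [← hnq, ← hA, e1, e2] at hsq
  -- the kernel bound on `p`
  have hkp : (star (T *ᵥ p) ⬝ᵥ (S *ᵥ (T *ᵥ p))).re ≤ κ * np := by
    have h := hker ψ hψ
    rw [← hp, ← hnp] at h
    exact h
  have hnp1 : np ≤ 1 := by linarith
  -- assemble: Rayleigh ≥ E₀ + λ A + 2 t η ≥ E₀ − (t²/λ) κ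
  rw [hR]
  have hlamA : lam * A + 2 * t * η ≤ A + 2 * t * η + t * θ := by
    -- `t θ ≥ −tτ nq ≥ −(tτ/g) A`, i.e. `(1 − λ) A + t θ ≥ 0`
    have h1 : t * τ * nq ≤ t * τ / g * A := by
      rw [div_mul_eq_mul_div, le_div_iff₀ hg]
      calc t * τ * nq * g = t * τ * (g * nq) := by ring
        _ ≤ t * τ * A := mul_le_mul_of_nonneg_left hAq (by positivity)
    have h2 : -(t * τ * nq) ≤ t * θ := by
      have := mul_le_mul_of_nonneg_left hθq ht0
      linarith
    rw [hlam]
    nlinarith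
  -- completing the square: `λ A + 2 t η ≥ −(t²/λ) ⟨Tp, S Tp⟩`
  have hcs : -(t ^ 2 / lam * (star (T *ᵥ p) ⬝ᵥ (S *ᵥ (T *ᵥ p))).re) ≤ lam * A + 2 * t * η := by
    -- multiply `hsq` by `λ > 0`
    have h := mul_nonneg hlam0.le hsq
    have e : lam * (A + 2 * (t / lam * η) + (t / lam) ^ 2 * (star (T *ᵥ p) ⬝ᵥ (S *ᵥ (T *ᵥ p))).re) =
        lam * A + 2 * t * η + t ^ 2 / lam * (star (T *ᵥ p) ⬝ᵥ (S *ᵥ (T *ᵥ p))).re := by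
      field_simp
    rw [e] at h
    linarith
  have hfin : -(t ^ 2 * κ / lam) ≤ -(t ^ 2 / lam * (star (T *ᵥ p) ⬝ᵥ (S *ᵥ (T *ᵥ p))).re) := by
    rw [neg_le_neg_iff]
    have h1 : t ^ 2 / lam * (star (T *ᵥ p) ⬝ᵥ (S *ᵥ (T *ᵥ p))).re ≤ t ^ 2 / lam * (κ * np) :=
      mul_le_mul_of_nonneg_left hkp (by positivity)
    have h2 : t ^ 2 / lam * (κ * np) ≤ t ^ 2 / lam * κ := by
      have : κ * np ≤ κ := by nlinarith
      exact mul_le_mul_of_nonneg_left this (by positivity)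
    calc _ ≤ _ := h1
      _ ≤ _ := h2
      _ = t ^ 2 * κ / lam := by ring
  linarith

end Summit.HubbardSuperconductivity.HubbardSuperconductivity.Theorems.AnisotropyChord.DressSecond

end
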